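import Mathlib
import HarnessLib
import Summits.NavierStokesRegularity.NavierStokesRegularity.Theorems.PoloidalWindowDoorLrcModEntireTwistingTHOscRoadPlane
import Summits.NavierStokesRegularity.NavierStokesRegularity.Theorems.PoloidalWindowDoorLrcModEntireTwistingTHOscSignedLiouville
import Summits.NavierStokesRegularity.NavierStokesRegularity.Theorems.PoloidalWindowDoorLrcModEntireTwistingTHOscSimilarityObjectSigned

/-!
# Item `LrcModEntire` (stmt-NavierStokesRegularity-20428), skeleton twist_split v6 — the CLASS road to `stub_twistingTHGerm` BY NAME from a
# SIGNED, SMOOTH physical-variable plane-oscillation object (both size currencies)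

Cell ns-regularity-ideate, seat ns-k2-port-2 g4 (kernel-port lineage; `--supports stmt-NavierStokesRegularity-20428 --as helper`; LEAD ns-poloidal-K2-p3 g13
GO 2026-08-29T03:04:39Z).  The LEAD's `…TwistingTHOscRoadPlane.twistingTHGerm_of_planeOscObject` (p689403) / `…RoadPlanePoly` (p691376) take a NON-NEGATIVE
`C²` object `O` obeying (OSC) pointwise.  The object that the remaining wall (BRANCH) (memo OSC-LIOUVILLE-g13 v1.5 §5septies) actually produces is
`U := (1−μ)(Θ⁺ − Θ⁻)` (plane-extremizer branches `Θ± = v₂(t,x±(t,z),z)`, slope `μ(t,z)`): SMOOTH, of both signs, and — by port-2's touching lemma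
`osc_sub_sup` applied with the roles of max/min swapped where `1−μ < 0` — obeying the SIGNED law `U·(∂ₜU + ½∂_z(S·U) − ∂_zzU) ≤ 0` everywhere
(trivially at `μ = 1`, where `U = 0`), whereas `|U|` is merely Lipschitz across the planes `μ = 1`.  This file is the road for that object:

* `eq_zero_of_signedPlaneOscObject_poly` — class + poloidal + (TH) window + the SIGNED object with POLYNOMIAL size `√(−t)|U| ≤ c(1 + z²/(−t))^k`
  (regularity, signed law, `√(−t)|S| ≤ A`, scale-invariant polynomial bounds on `∂ₜU, ∂_zU, ∂_zzU, ∂_zS`, and the plane majorant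
  `|(1−μ)(v₂(t,y) − v₂(t,y′))| ≤ |U(t,z)|` on proportional-shear planes) ⇒ `v ≡ 0`
  (`simSignedObject_of_planeSignedObject` ∘ `eq_zero_of_ancient_signedSolution` ∘ the LEAD's ending `eq_zero_of_weightOsc_zero`);
* `eq_zero_of_signedPlaneOscObject` — the same with the bounded size currency `√(−t)|U| ≤ c`;
* `twistingTHGerm_of_signedPlaneOscObject_poly`, `twistingTHGerm_of_signedPlaneOscObject` — the registered signature of `stub_twistingTHGerm` VERBATIM
  from the signed object supplied per normalised windowed profile.
So the (TH) column of `LrcModEntire` = produce the SIGNED smooth object — no sign bookkeeping at `μ = 1` is left; the next brick is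
`signedPlaneOscObject_of_branches` ((BRANCH) + non-degeneracy of `Hessₕv₂` at the extremizers + non-flatness + class rates ⇒ this INPUT list).

WHAT THIS IS NOT: not a claim about Navier–Stokes regularity and not a proof of the stub — a reduction BY NAME to a typed analytic hypothesis
(bears_on LADDER-NS N0, item 20428 / crux 19708; both OPEN).
-/

noncomputable section

-- the summit and its single sub-problem share the name (CONVENTIONS §1), as in every Theorems file
set_option linter.dupNamespace false

namespace Summit.NavierStokesRegularity.NavierStokesRegularity.Theorems.PoloidalWindowDoorLrcModEntireTwistingTHOscRoadSigned

open Set Filter Topology Function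
open scoped RealInnerProductSpace InnerProductSpace Laplacian
open Literature.Analysis Literature.Analysis.FluidPDE
open Summit.NavierStokesRegularity.NavierStokesRegularity.Theorems.PoloidalWindowDoorLrcModEntireTwistingTHOscSimilarityDefs
open Summit.NavierStokesRegularity.NavierStokesRegularity.Theorems.PoloidalWindowDoorLrcModEntireTwistingTHOscSimilarityTransform
open Summit.NavierStokesRegularity.NavierStokesRegularity.Theorems.PoloidalWindowDoorLrcModEntireTwistingTHOscSimilarityObjectSigned
open Summit.NavierStokesRegularity.NavierStokesRegularity.Theorems.PoloidalWindowDoorLrcModEntireTwistingTHOscSignedLiouville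
open Summit.NavierStokesRegularity.NavierStokesRegularity.Theorems.PoloidalWindowDoorLrcModEntireTwistingTHOscRoadPlane

/-- **CLASS + POLOIDAL + (TH) WINDOW + THE SIGNED PHYSICAL-VARIABLE OBJECT (POLYNOMIAL SIZE) ⇒ `v ≡ 0`.**  The object (t < 0 throughout):
`U, S : ℝ → ℝ → ℝ` of `(t,z)` and the joint derivative `Ud t z` of `uncurry U`; regularity (`U(t,·) ∈ C²`, `S(t,·) ∈ C¹`, `∂ₜU` continuous in `z`);
the SIGNED law `U·(∂ₜU + ½∂_z(S·U) − ∂_zzU) ≤ 0` pointwise; the sizes `√(−t)|U| ≤ c(1 + z²/(−t))^k`, `√(−t)|S| ≤ A`; scale-invariant polynomial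
bounds on `∂ₜU, ∂_zU, ∂_zzU, ∂_zS`; and the PLANE MAJORANT: on every proportional-shear plane `{y₂ = z}` (slope `μ`) of every slice `t < 0`,
`|(1−μ)(v₂(t,y) − v₂(t,y′))| ≤ |U(t,z)|`. -/
theorem eq_zero_of_signedPlaneOscObject_poly {C : ℝ} {v : ℝ → EuclideanSpace ℝ (Fin 3) → EuclideanSpace ℝ (Fin 3)}
    (hrate : HasTypeITimeDecay C v) (hcont : ContinuousOn (uncurry v) (Iio (0 : ℝ) ×ˢ univ))
    (hmild : ∀ s t : ℝ, s < t → t < 0 → ∀ x,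
      v t x = UnboundedOperators.heatExtension (v s) (t - s) x - oseenDuhamel 1 s v v t x)
    (hdiv : ∀ t < 0, VectorCalculus.IsDivFree (v t))
    (hpol : ∀ s < 0, ∀ y, ⟪curl (v s) y, EuclideanSpace.single 2 1⟫_ℝ = 0)
    {W : Set (ℝ × EuclideanSpace ℝ (Fin 3))} (hW : IsOpen W) (hWne : W.Nonempty) (hWs : W ⊆ Iio (0 : ℝ) ×ˢ univ)
    {m : ℝ → ℝ → ℝ}
    (hTH : ∀ z ∈ W, ∀ b : Fin 3, b ≠ 2 →
      fderiv ℝ (v z.1) z.2 (EuclideanSpace.single 2 1) b = m z.1 (z.2 2) * fderiv ℝ (v z.1) z.2 (EuclideanSpace.single b 1) 2)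
    (hObj : ∃ (U S : ℝ → ℝ → ℝ) (Ud : ℝ → ℝ → (ℝ × ℝ →L[ℝ] ℝ)) (c A K : ℝ) (k : ℕ),
        (∀ t < 0, ∀ z, HasFDerivAt (Function.uncurry U) (Ud t z) (t, z)) ∧
        (∀ t < 0, Continuous fun z => Ud t z (1, 0)) ∧
        (∀ t < 0, ContDiff ℝ 2 (U t)) ∧ (∀ t < 0, ContDiff ℝ 1 (S t)) ∧
        (∀ t < 0, ∀ z, U t z * (Ud t z (1, 0) + (1 / 2 : ℝ) * deriv (fun z => S t z * U t z) z - deriv (deriv (U t)) z) ≤ 0) ∧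
        (∀ t < 0, ∀ z, Real.sqrt (-t) * |U t z| ≤ c * (1 + z ^ 2 / (-t)) ^ k) ∧
        (∀ t < 0, ∀ z, Real.sqrt (-t) * |S t z| ≤ A) ∧
        (∀ t < 0, ∀ z, Real.sqrt (-t) * (-t) * |Ud t z (1, 0)| ≤ K * (1 + z ^ 2 / (-t)) ^ k) ∧
        (∀ t < 0, ∀ z, (-t) * |deriv (U t) z| ≤ K * (1 + z ^ 2 / (-t)) ^ k) ∧
        (∀ t < 0, ∀ z, Real.sqrt (-t) * (-t) * |deriv (deriv (U t)) z| ≤ K * (1 + z ^ 2 / (-t)) ^ k) ∧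
        (∀ t < 0, ∀ z, (-t) * |deriv (S t) z| ≤ K * (1 + z ^ 2 / (-t)) ^ k) ∧
        (∀ t : ℝ, t < 0 → ∀ z μ : ℝ,
          (∀ y : EuclideanSpace ℝ (Fin 3), y 2 = z → ∀ b : Fin 3, b ≠ 2 →
            fderiv ℝ (v t) y (EuclideanSpace.single 2 1) b = μ * fderiv ℝ (v t) y (EuclideanSpace.single b 1) 2) →
          ∀ y y' : EuclideanSpace ℝ (Fin 3), y 2 = z → y' 2 = z → |(1 - μ) * (v t y 2 - v t y' 2)| ≤ |U t z|)) :
    ∀ t < 0, ∀ x, v t x = 0 := by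
  obtain ⟨U, S, Ud, c, A, K, k, hUF, hUtc, hU2, hS1, hsgn, hc, hSA, hUt, hUz, hUzz, hSz, hmaj⟩ := hObj
  -- the signed similarity object (this seat) and the signed ancient Liouville theorem for every compression
  obtain ⟨Qt, hQ2, hQt, hQtc, hQb, hQtb, hQ1b, hQ2b, hSS, hSSA, hSS1, hsgn'⟩ :=
    simSignedObject_of_planeSignedObject hUF hUtc hU2 hS1 hsgn hc hSA hUt hUz hUzz hSz
  have hSSA' : ∀ τ ξ, |simQ S τ ξ| ≤ max A 1 := fun τ ξ => (hSSA τ ξ).trans (le_max_left A 1)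
  have hQ0 : ∀ τ ξ, simQ U τ ξ = 0 :=
    eq_zero_of_ancient_signedSolution (lt_of_lt_of_le one_pos (le_max_right A 1)) hQ2 hQt hQtc hQb hQtb hQ1b hQ2b hSS hSSA' hSS1 hsgn'
  -- back to physical variables: `U ≡ 0` on the slab
  have hU0 : ∀ t < 0, ∀ z, U t z = 0 := by
    intro t ht z
    obtain ⟨τ, ξ, hτ, hξ⟩ := exists_sim_preimage ht z
    have h := hQ0 τ ξ
    unfold simQ at h
    rw [hτ, hξ] at h
    rcases mul_eq_zero.1 h with h1 | h1
    · exact absurd h1 (sig_pos τ).ne'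
    · exact h1
  -- the weight oscillation vanishes on proportional-shear planes of the slice `−1`
  refine eq_zero_of_weightOsc_zero hrate hcont hmild hdiv hpol hW hWne hWs hTH fun z μ hμ y y' hy hy' => ?_
  have h := hmaj (-1) (by norm_num) z μ hμ y y' hy hy'
  rw [hU0 (-1) (by norm_num) z, abs_zero] at h
  exact abs_eq_zero.1 (le_antisymm h (abs_nonneg _))

/-- **The same with the BOUNDED size currency** `√(−t)|U| ≤ c` (the Type-I dictionary of the hot-spot normalisation). -/
theorem eq_zero_of_signedPlaneOscObject {C : ℝ} {v : ℝ → EuclideanSpace ℝ (Fin 3) → EuclideanSpace ℝ (Fin 3)}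
    (hrate : HasTypeITimeDecay C v) (hcont : ContinuousOn (uncurry v) (Iio (0 : ℝ) ×ˢ univ))
    (hmild : ∀ s t : ℝ, s < t → t < 0 → ∀ x,
      v t x = UnboundedOperators.heatExtension (v s) (t - s) x - oseenDuhamel 1 s v v t x)
    (hdiv : ∀ t < 0, VectorCalculus.IsDivFree (v t))
    (hpol : ∀ s < 0, ∀ y, ⟪curl (v s) y, EuclideanSpace.single 2 1⟫_ℝ = 0)
    {W : Set (ℝ × EuclideanSpace ℝ (Fin 3))} (hW : IsOpen W) (hWne : W.Nonempty) (hWs : W ⊆ Iio (0 : ℝ) ×ˢ univ)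
    {m : ℝ → ℝ → ℝ}
    (hTH : ∀ z ∈ W, ∀ b : Fin 3, b ≠ 2 →
      fderiv ℝ (v z.1) z.2 (EuclideanSpace.single 2 1) b = m z.1 (z.2 2) * fderiv ℝ (v z.1) z.2 (EuclideanSpace.single b 1) 2)
    (hObj : ∃ (U S : ℝ → ℝ → ℝ) (Ud : ℝ → ℝ → (ℝ × ℝ →L[ℝ] ℝ)) (c A K : ℝ) (k : ℕ),
        (∀ t < 0, ∀ z, HasFDerivAt (Function.uncurry U) (Ud t z) (t, z)) ∧
        (∀ t < 0, Continuous fun z => Ud t z (1, 0)) ∧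
        (∀ t < 0, ContDiff ℝ 2 (U t)) ∧ (∀ t < 0, ContDiff ℝ 1 (S t)) ∧
        (∀ t < 0, ∀ z, U t z * (Ud t z (1, 0) + (1 / 2 : ℝ) * deriv (fun z => S t z * U t z) z - deriv (deriv (U t)) z) ≤ 0) ∧
        (∀ t < 0, ∀ z, Real.sqrt (-t) * |U t z| ≤ c) ∧
        (∀ t < 0, ∀ z, Real.sqrt (-t) * |S t z| ≤ A) ∧
        (∀ t < 0, ∀ z, Real.sqrt (-t) * (-t) * |Ud t z (1, 0)| ≤ K * (1 + z ^ 2 / (-t)) ^ k) ∧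
        (∀ t < 0, ∀ z, (-t) * |deriv (U t) z| ≤ K * (1 + z ^ 2 / (-t)) ^ k) ∧
        (∀ t < 0, ∀ z, Real.sqrt (-t) * (-t) * |deriv (deriv (U t)) z| ≤ K * (1 + z ^ 2 / (-t)) ^ k) ∧
        (∀ t < 0, ∀ z, (-t) * |deriv (S t) z| ≤ K * (1 + z ^ 2 / (-t)) ^ k) ∧
        (∀ t : ℝ, t < 0 → ∀ z μ : ℝ,
          (∀ y : EuclideanSpace ℝ (Fin 3), y 2 = z → ∀ b : Fin 3, b ≠ 2 →
            fderiv ℝ (v t) y (EuclideanSpace.single 2 1) b = μ * fderiv ℝ (v t) y (EuclideanSpace.single b 1) 2) →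
          ∀ y y' : EuclideanSpace ℝ (Fin 3), y 2 = z → y' 2 = z → |(1 - μ) * (v t y 2 - v t y' 2)| ≤ |U t z|)) :
    ∀ t < 0, ∀ x, v t x = 0 := by
  obtain ⟨U, S, Ud, c, A, K, k, hUF, hUtc, hU2, hS1, hsgn, hc, hSA, hUt, hUz, hUzz, hSz, hmaj⟩ := hObj
  have hc0 : 0 ≤ c := by
    have h := hc (-1) (by norm_num) 0
    have h1 : 0 ≤ Real.sqrt (-(-1:ℝ)) * |U (-1) 0| := by positivity
    linarith
  have hc' : ∀ t < 0, ∀ z, Real.sqrt (-t) * |U t z| ≤ c * (1 + z ^ 2 / (-t)) ^ k := by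
    intro t ht z
    have hP : 1 ≤ (1 + z ^ 2 / (-t)) ^ k := one_le_pow₀ (by
      have : 0 ≤ z ^ 2 / (-t) := div_nonneg (sq_nonneg z) (by linarith)
      linarith)
    calc Real.sqrt (-t) * |U t z| ≤ c := hc t ht z
      _ = c * 1 := (mul_one c).symm
      _ ≤ c * (1 + z ^ 2 / (-t)) ^ k := mul_le_mul_of_nonneg_left hP hc0
  exact eq_zero_of_signedPlaneOscObject_poly hrate hcont hmild hdiv hpol hW hWne hWs hTH
    ⟨U, S, Ud, c, A, K, k, hUF, hUtc, hU2, hS1, hsgn, hc', hSA, hUt, hUz, hUzz, hSz, hmaj⟩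

/-- **THE CLASS ROAD TO `stub_twistingTHGerm` BY NAME, SIGNED OBJECT, POLYNOMIAL SIZE.**  If every poloidal class profile normalised at the hot spot
and carrying a (TH) window admits the signed (t,z)-object of `eq_zero_of_signedPlaneOscObject_poly`, then the registered signature of
`stub_twistingTHGerm` (skeleton `Cruxes/LrcModEntire/Lines/twist_split.lean` v6) holds. -/
theorem twistingTHGerm_of_signedPlaneOscObject_poly
    (hH : ∀ (C : ℝ) (v : ℝ → EuclideanSpace ℝ (Fin 3) → EuclideanSpace ℝ (Fin 3)),
      Literature.Analysis.FluidPDE.HasTypeITimeDecay C v →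
      ContinuousOn (Function.uncurry v) (Set.Iio (0 : ℝ) ×ˢ Set.univ) →
      (∀ s t : ℝ, s < t → t < 0 → ∀ x, v t x =
        Literature.Analysis.UnboundedOperators.heatExtension (v s) (t - s) x -
          Literature.Analysis.FluidPDE.oseenDuhamel 1 s v v t x) →
      (∀ t < 0, Literature.Analysis.FluidPDE.VectorCalculus.IsDivFree (v t)) →
      (∀ s < 0, ∀ y, ⟪Literature.Analysis.FluidPDE.curl (v s) y, EuclideanSpace.single 2 1⟫_ℝ = 0) →
      v (-1) 0 2 ≠ 0 → (∀ t < 0, ∀ x, Real.sqrt (-t) * |v t x 2| ≤ |v (-1) 0 2|) →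
      ∀ W : Set (ℝ × EuclideanSpace ℝ (Fin 3)), IsOpen W → W.Nonempty → W ⊆ Set.Iio (0 : ℝ) ×ˢ Set.univ →
        (∃ m : ℝ → ℝ → ℝ, ∀ z ∈ W, ∀ b : Fin 3, b ≠ 2 →
            fderiv ℝ (v z.1) z.2 (EuclideanSpace.single 2 1) b =
              m z.1 (z.2 2) * fderiv ℝ (v z.1) z.2 (EuclideanSpace.single b 1) 2) →
        ∃ (U S : ℝ → ℝ → ℝ) (Ud : ℝ → ℝ → (ℝ × ℝ →L[ℝ] ℝ)) (c A K : ℝ) (k : ℕ),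
          (∀ t < 0, ∀ z, HasFDerivAt (Function.uncurry U) (Ud t z) (t, z)) ∧
          (∀ t < 0, Continuous fun z => Ud t z (1, 0)) ∧
          (∀ t < 0, ContDiff ℝ 2 (U t)) ∧ (∀ t < 0, ContDiff ℝ 1 (S t)) ∧
          (∀ t < 0, ∀ z, U t z * (Ud t z (1, 0) + (1 / 2 : ℝ) * deriv (fun z => S t z * U t z) z - deriv (deriv (U t)) z) ≤ 0) ∧
          (∀ t < 0, ∀ z, Real.sqrt (-t) * |U t z| ≤ c * (1 + z ^ 2 / (-t)) ^ k) ∧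
          (∀ t < 0, ∀ z, Real.sqrt (-t) * |S t z| ≤ A) ∧
          (∀ t < 0, ∀ z, Real.sqrt (-t) * (-t) * |Ud t z (1, 0)| ≤ K * (1 + z ^ 2 / (-t)) ^ k) ∧
          (∀ t < 0, ∀ z, (-t) * |deriv (U t) z| ≤ K * (1 + z ^ 2 / (-t)) ^ k) ∧
          (∀ t < 0, ∀ z, Real.sqrt (-t) * (-t) * |deriv (deriv (U t)) z| ≤ K * (1 + z ^ 2 / (-t)) ^ k) ∧
          (∀ t < 0, ∀ z, (-t) * |deriv (S t) z| ≤ K * (1 + z ^ 2 / (-t)) ^ k) ∧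
          (∀ t : ℝ, t < 0 → ∀ z μ : ℝ,
            (∀ y : EuclideanSpace ℝ (Fin 3), y 2 = z → ∀ b : Fin 3, b ≠ 2 →
              fderiv ℝ (v t) y (EuclideanSpace.single 2 1) b = μ * fderiv ℝ (v t) y (EuclideanSpace.single b 1) 2) →
            ∀ y y' : EuclideanSpace ℝ (Fin 3), y 2 = z → y' 2 = z → |(1 - μ) * (v t y 2 - v t y' 2)| ≤ |U t z|)) :
    ∀ (C : ℝ) (v : ℝ → EuclideanSpace ℝ (Fin 3) → EuclideanSpace ℝ (Fin 3)),
      Literature.Analysis.FluidPDE.HasTypeITimeDecay C v →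
      ContinuousOn (Function.uncurry v) (Set.Iio (0 : ℝ) ×ˢ Set.univ) →
      (∀ s t : ℝ, s < t → t < 0 → ∀ x, v t x =
        Literature.Analysis.UnboundedOperators.heatExtension (v s) (t - s) x -
          Literature.Analysis.FluidPDE.oseenDuhamel 1 s v v t x) →
      (∀ t < 0, Literature.Analysis.FluidPDE.VectorCalculus.IsDivFree (v t)) →
      (∀ s < 0, ∀ y, ⟪Literature.Analysis.FluidPDE.curl (v s) y, EuclideanSpace.single 2 1⟫_ℝ = 0) →
      v (-1) 0 2 ≠ 0 → (∀ t < 0, ∀ x, Real.sqrt (-t) * |v t x 2| ≤ |v (-1) 0 2|) →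
      (∀ h : EuclideanSpace ℝ (Fin 3), fderiv ℝ (v (-1)) 0 h 2 = 0) →
      (deriv (fun s => v s 0 2) (-1) = v (-1) 0 2 / 2 ∧ v (-1) 0 2 * (Δ (fun y => v (-1) y 2)) 0 ≤ 0) →
      ∀ W : Set (ℝ × EuclideanSpace ℝ (Fin 3)), IsOpen W → W.Nonempty → W ⊆ Set.Iio (0 : ℝ) ×ˢ Set.univ →
        (∀ z ∈ W, (Literature.Analysis.FluidPDE.curl (v z.1) z.2 ≠ 0 ∧
            (fderiv ℝ (v z.1) z.2 (EuclideanSpace.single 0 1) 2 ≠ 0 ∨ fderiv ℝ (v z.1) z.2 (EuclideanSpace.single 1 1) 2 ≠ 0) ∧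
            (fderiv ℝ (v z.1) z.2 (EuclideanSpace.single 2 1) 0 ≠ 0 ∨ fderiv ℝ (v z.1) z.2 (EuclideanSpace.single 2 1) 1 ≠ 0))) →
        (∀ m : ℝ → ℝ, ∀ W₁ : Set (ℝ × EuclideanSpace ℝ (Fin 3)), W₁ ⊆ W → IsOpen W₁ → W₁.Nonempty →
            ∃ z ∈ W₁, ∃ b : Fin 3, b ≠ 2 ∧
              fderiv ℝ (v z.1) z.2 (EuclideanSpace.single 2 1) b ≠
                m z.1 * fderiv ℝ (v z.1) z.2 (EuclideanSpace.single b 1) 2) →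
        (∀ z ∈ W, (fderiv ℝ (fun x => fderiv ℝ (v z.1) x (EuclideanSpace.single 2 1) 2) z.2 (EuclideanSpace.single 0 1) *
                fderiv ℝ (v z.1) z.2 (EuclideanSpace.single 1 1) 2 -
              fderiv ℝ (fun x => fderiv ℝ (v z.1) x (EuclideanSpace.single 2 1) 2) z.2 (EuclideanSpace.single 1 1) *
                fderiv ℝ (v z.1) z.2 (EuclideanSpace.single 0 1) 2 ≠ 0)) →
        (∃ m : ℝ → ℝ → ℝ, ∀ z ∈ W, ∀ b : Fin 3, b ≠ 2 →
            fderiv ℝ (v z.1) z.2 (EuclideanSpace.single 2 1) b =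
              m z.1 (z.2 2) * fderiv ℝ (v z.1) z.2 (EuclideanSpace.single b 1) 2) →
        ∃ s : ℝ, s < 0 ∧ ∃ U : Set (EuclideanSpace ℝ (Fin 3)), IsOpen U ∧ U.Nonempty ∧
          ((∃ e : EuclideanSpace ℝ (Fin 3), e ≠ 0 ∧
              ∀ y ∈ U, fderiv ℝ (Literature.Analysis.FluidPDE.curl (v s)) y e = 0) ∨
           (∃ c : EuclideanSpace ℝ (Fin 3), ∀ y ∈ U,
              Literature.Analysis.FluidPDE.rotGen (Literature.Analysis.FluidPDE.curl (v s) y) =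
                fderiv ℝ (Literature.Analysis.FluidPDE.curl (v s)) y (Literature.Analysis.FluidPDE.rotGen (y - c))) ∨
           (∃ w : EuclideanSpace ℝ (Fin 3) → EuclideanSpace ℝ (Fin 3), AnalyticOnNhd ℝ w Set.univ ∧
              ¬ BddAbove (Set.range fun y => ‖w y‖) ∧ ∀ y ∈ U, v s y = w y)) := by
  intro C v hrate hcont hmild hdiv hpol hne hhot _hthread _hpins W hW hWne hWs _hnd _hpin _htw hTH
  obtain ⟨m, hm⟩ := hTH
  have hzero := eq_zero_of_signedPlaneOscObject_poly hrate hcont hmild hdiv hpol hW hWne hWs hm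
    (hH C v hrate hcont hmild hdiv hpol hne hhot W hW hWne hWs ⟨m, hm⟩)
  have h0 : v (-1) 0 = 0 := hzero (-1) (by norm_num) 0
  exact absurd (by rw [h0]; rfl) hne

/-- **THE CLASS ROAD TO `stub_twistingTHGerm` BY NAME, SIGNED OBJECT, BOUNDED SIZE** (`√(−t)|U| ≤ c`). -/
theorem twistingTHGerm_of_signedPlaneOscObject
    (hH : ∀ (C : ℝ) (v : ℝ → EuclideanSpace ℝ (Fin 3) → EuclideanSpace ℝ (Fin 3)),
      Literature.Analysis.FluidPDE.HasTypeITimeDecay C v →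
      ContinuousOn (Function.uncurry v) (Set.Iio (0 : ℝ) ×ˢ Set.univ) →
      (∀ s t : ℝ, s < t → t < 0 → ∀ x, v t x =
        Literature.Analysis.UnboundedOperators.heatExtension (v s) (t - s) x -
          Literature.Analysis.FluidPDE.oseenDuhamel 1 s v v t x) →
      (∀ t < 0, Literature.Analysis.FluidPDE.VectorCalculus.IsDivFree (v t)) →
      (∀ s < 0, ∀ y, ⟪Literature.Analysis.FluidPDE.curl (v s) y, EuclideanSpace.single 2 1⟫_ℝ = 0) →
      v (-1) 0 2 ≠ 0 → (∀ t < 0, ∀ x, Real.sqrt (-t) * |v t x 2| ≤ |v (-1) 0 2|) →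
      ∀ W : Set (ℝ × EuclideanSpace ℝ (Fin 3)), IsOpen W → W.Nonempty → W ⊆ Set.Iio (0 : ℝ) ×ˢ Set.univ →
        (∃ m : ℝ → ℝ → ℝ, ∀ z ∈ W, ∀ b : Fin 3, b ≠ 2 →
            fderiv ℝ (v z.1) z.2 (EuclideanSpace.single 2 1) b =
              m z.1 (z.2 2) * fderiv ℝ (v z.1) z.2 (EuclideanSpace.single b 1) 2) →
        ∃ (U S : ℝ → ℝ → ℝ) (Ud : ℝ → ℝ → (ℝ × ℝ →L[ℝ] ℝ)) (c A K : ℝ) (k : ℕ),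
          (∀ t < 0, ∀ z, HasFDerivAt (Function.uncurry U) (Ud t z) (t, z)) ∧
          (∀ t < 0, Continuous fun z => Ud t z (1, 0)) ∧
          (∀ t < 0, ContDiff ℝ 2 (U t)) ∧ (∀ t < 0, ContDiff ℝ 1 (S t)) ∧
          (∀ t < 0, ∀ z, U t z * (Ud t z (1, 0) + (1 / 2 : ℝ) * deriv (fun z => S t z * U t z) z - deriv (deriv (U t)) z) ≤ 0) ∧
          (∀ t < 0, ∀ z, Real.sqrt (-t) * |U t z| ≤ c) ∧
          (∀ t < 0, ∀ z, Real.sqrt (-t) * |S t z| ≤ A) ∧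
          (∀ t < 0, ∀ z, Real.sqrt (-t) * (-t) * |Ud t z (1, 0)| ≤ K * (1 + z ^ 2 / (-t)) ^ k) ∧
          (∀ t < 0, ∀ z, (-t) * |deriv (U t) z| ≤ K * (1 + z ^ 2 / (-t)) ^ k) ∧
          (∀ t < 0, ∀ z, Real.sqrt (-t) * (-t) * |deriv (deriv (U t)) z| ≤ K * (1 + z ^ 2 / (-t)) ^ k) ∧
          (∀ t < 0, ∀ z, (-t) * |deriv (S t) z| ≤ K * (1 + z ^ 2 / (-t)) ^ k) ∧
          (∀ t : ℝ, t < 0 → ∀ z μ : ℝ,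
            (∀ y : EuclideanSpace ℝ (Fin 3), y 2 = z → ∀ b : Fin 3, b ≠ 2 →
              fderiv ℝ (v t) y (EuclideanSpace.single 2 1) b = μ * fderiv ℝ (v t) y (EuclideanSpace.single b 1) 2) →
            ∀ y y' : EuclideanSpace ℝ (Fin 3), y 2 = z → y' 2 = z → |(1 - μ) * (v t y 2 - v t y' 2)| ≤ |U t z|)) :
    ∀ (C : ℝ) (v : ℝ → EuclideanSpace ℝ (Fin 3) → EuclideanSpace ℝ (Fin 3)),
      Literature.Analysis.FluidPDE.HasTypeITimeDecay C v →
      ContinuousOn (Function.uncurry v) (Set.Iio (0 : ℝ) ×ˢ Set.univ) →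
      (∀ s t : ℝ, s < t → t < 0 → ∀ x, v t x =
        Literature.Analysis.UnboundedOperators.heatExtension (v s) (t - s) x -
          Literature.Analysis.FluidPDE.oseenDuhamel 1 s v v t x) →
      (∀ t < 0, Literature.Analysis.FluidPDE.VectorCalculus.IsDivFree (v t)) →
      (∀ s < 0, ∀ y, ⟪Literature.Analysis.FluidPDE.curl (v s) y, EuclideanSpace.single 2 1⟫_ℝ = 0) →
      v (-1) 0 2 ≠ 0 → (∀ t < 0, ∀ x, Real.sqrt (-t) * |v t x 2| ≤ |v (-1) 0 2|) →
      (∀ h : EuclideanSpace ℝ (Fin 3), fderiv ℝ (v (-1)) 0 h 2 = 0) →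
      (deriv (fun s => v s 0 2) (-1) = v (-1) 0 2 / 2 ∧ v (-1) 0 2 * (Δ (fun y => v (-1) y 2)) 0 ≤ 0) →
      ∀ W : Set (ℝ × EuclideanSpace ℝ (Fin 3)), IsOpen W → W.Nonempty → W ⊆ Set.Iio (0 : ℝ) ×ˢ Set.univ →
        (∀ z ∈ W, (Literature.Analysis.FluidPDE.curl (v z.1) z.2 ≠ 0 ∧
            (fderiv ℝ (v z.1) z.2 (EuclideanSpace.single 0 1) 2 ≠ 0 ∨ fderiv ℝ (v z.1) z.2 (EuclideanSpace.single 1 1) 2 ≠ 0) ∧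
            (fderiv ℝ (v z.1) z.2 (EuclideanSpace.single 2 1) 0 ≠ 0 ∨ fderiv ℝ (v z.1) z.2 (EuclideanSpace.single 2 1) 1 ≠ 0))) →
        (∀ m : ℝ → ℝ, ∀ W₁ : Set (ℝ × EuclideanSpace ℝ (Fin 3)), W₁ ⊆ W → IsOpen W₁ → W₁.Nonempty →
            ∃ z ∈ W₁, ∃ b : Fin 3, b ≠ 2 ∧
              fderiv ℝ (v z.1) z.2 (EuclideanSpace.single 2 1) b ≠
                m z.1 * fderiv ℝ (v z.1) z.2 (EuclideanSpace.single b 1) 2) →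
        (∀ z ∈ W, (fderiv ℝ (fun x => fderiv ℝ (v z.1) x (EuclideanSpace.single 2 1) 2) z.2 (EuclideanSpace.single 0 1) *
                fderiv ℝ (v z.1) z.2 (EuclideanSpace.single 1 1) 2 -
              fderiv ℝ (fun x => fderiv ℝ (v z.1) x (EuclideanSpace.single 2 1) 2) z.2 (EuclideanSpace.single 1 1) *
                fderiv ℝ (v z.1) z.2 (EuclideanSpace.single 0 1) 2 ≠ 0)) →
        (∃ m : ℝ → ℝ → ℝ, ∀ z ∈ W, ∀ b : Fin 3, b ≠ 2 →
            fderiv ℝ (v z.1) z.2 (EuclideanSpace.single 2 1) b =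
              m z.1 (z.2 2) * fderiv ℝ (v z.1) z.2 (EuclideanSpace.single b 1) 2) →
        ∃ s : ℝ, s < 0 ∧ ∃ U : Set (EuclideanSpace ℝ (Fin 3)), IsOpen U ∧ U.Nonempty ∧
          ((∃ e : EuclideanSpace ℝ (Fin 3), e ≠ 0 ∧
              ∀ y ∈ U, fderiv ℝ (Literature.Analysis.FluidPDE.curl (v s)) y e = 0) ∨
           (∃ c : EuclideanSpace ℝ (Fin 3), ∀ y ∈ U,
              Literature.Analysis.FluidPDE.rotGen (Literature.Analysis.FluidPDE.curl (v s) y) =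
                fderiv ℝ (Literature.Analysis.FluidPDE.curl (v s)) y (Literature.Analysis.FluidPDE.rotGen (y - c))) ∨
           (∃ w : EuclideanSpace ℝ (Fin 3) → EuclideanSpace ℝ (Fin 3), AnalyticOnNhd ℝ w Set.univ ∧
              ¬ BddAbove (Set.range fun y => ‖w y‖) ∧ ∀ y ∈ U, v s y = w y)) := by
  intro C v hrate hcont hmild hdiv hpol hne hhot _hthread _hpins W hW hWne hWs _hnd _hpin _htw hTH
  obtain ⟨m, hm⟩ := hTH
  have hzero := eq_zero_of_signedPlaneOscObject hrate hcont hmild hdiv hpol hW hWne hWs hm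
    (hH C v hrate hcont hmild hdiv hpol hne hhot W hW hWne hWs ⟨m, hm⟩)
  have h0 : v (-1) 0 = 0 := hzero (-1) (by norm_num) 0
  exact absurd (by rw [h0]; rfl) hne

end Summit.NavierStokesRegularity.NavierStokesRegularity.Theorems.PoloidalWindowDoorLrcModEntireTwistingTHOscRoadSigned
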